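import Summits.KontsevichZagierPeriods.KontsevichZagierPeriods.Theorems.TerasomaMultiplicationMultiplicationAccessibleCornerStokesTheta1Deriv

/-!
# `MultiplicationAccessible` (stmt-KontsevichZagierPeriods-12305), line `shifted-family-prime-sieve`:
the `θ₁`-derivative of `c₀` as a bounded semialgebraic function on `W` (`cornerStokesTheta1Aux`)

`W` is open and `ℚ`-semialgebraic; `c₀` is `ℚ`-semialgebraic wherever the bases of its real powers
are non-negative (`CornerTheta1.isSemialgebraicFunOn_c0`, reused on the closed band by the
`θ₁`-move); `∂θ₁c₀` exists on `W` with the uniform bound `(704s + 2xs + 8x)·9^{3s}`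
(`CornerTheta1.hasDerivAt_c0`: product rule for `c₀ = −Pθ₁B/y`, the factor `1/y` absorbed by
`|B| ≤ 2xy`, `|∂θ₁B| ≤ 6xy` and the compensated bounds on `∂θ₁P`); the registered sub-goal
`cornerStokesTheta1Aux` follows by Basu–Pollack–Roy Prop. 3.22 (line derivatives of semialgebraic
functions are semialgebraic, `IsSemialgebraicFunOn.of_hasLineDerivAt`). Also recorded for the
`θ₁`-move: the base `B₁ = {(θ₂, y, v)}` of the `θ₁`-fibration of `W`, its ends
`a = max 0 (1 − θ₂ − 1/y)`, `b = min (1 − θ₂) (1/y)` (semialgebraic), the fibred description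
`W = {(θ₂,y,v) ∈ B₁, a < θ₁ < b}` and the sign conditions on the closed fibres.
References: Kontsevich–Zagier 2001 §1.2 rule (3); Basu–Pollack–Roy 2006 Prop. 3.22.
-/

noncomputable section

open MeasureTheory Set Real
open scoped BigOperators
open Literature.NumberTheory.Transcendental
open Literature.NumberTheory.Transcendental.KZ
open Literature.ModelTheory.ExponentialFields (IsSemialgebraic isSemialgebraic_setOf_eval_pos
  isSemialgebraic_setOf_eval_lt)
open MvPolynomial (aeval X C)

namespace Summit.KontsevichZagierPeriods.TerasomaMultiplication.MultiplicationAccessible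

namespace CornerTheta1

/-- `W` is `ℚ`-semialgebraic (finite intersection of strict polynomial inequalities). [folklore] -/
theorem isSemialgebraic_W :
    IsSemialgebraic ℚ {w : Fin 4 → ℝ | 0 < w 0 ∧ 0 < w 1 ∧ w 0 + w 1 < 1 ∧ 0 < w 2 ∧
      w 2 * (1 - w 0 - w 1) < 1 ∧ w 2 * w 0 < 1 ∧ w 2 * w 1 < 1 ∧ 0 < w 3 ∧ w 3 < 1} := by
  have h0 := isSemialgebraic_setOf_eval_pos (k := ℚ) (R := ℝ) (X 0 : MvPolynomial (Fin 4) ℚ)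
  have h1 := isSemialgebraic_setOf_eval_pos (k := ℚ) (R := ℝ) (X 1 : MvPolynomial (Fin 4) ℚ)
  have h2 := isSemialgebraic_setOf_eval_lt (k := ℚ) (R := ℝ) (X 0 + X 1 : MvPolynomial (Fin 4) ℚ) 1
  have h3 := isSemialgebraic_setOf_eval_pos (k := ℚ) (R := ℝ) (X 2 : MvPolynomial (Fin 4) ℚ)
  have h4 := isSemialgebraic_setOf_eval_lt (k := ℚ) (R := ℝ)
    (X 2 * (1 - X 0 - X 1) : MvPolynomial (Fin 4) ℚ) 1
  have h5 := isSemialgebraic_setOf_eval_lt (k := ℚ) (R := ℝ) (X 2 * X 0 : MvPolynomial (Fin 4) ℚ) 1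
  have h6 := isSemialgebraic_setOf_eval_lt (k := ℚ) (R := ℝ) (X 2 * X 1 : MvPolynomial (Fin 4) ℚ) 1
  have h7 := isSemialgebraic_setOf_eval_pos (k := ℚ) (R := ℝ) (X 3 : MvPolynomial (Fin 4) ℚ)
  have h8 := isSemialgebraic_setOf_eval_lt (k := ℚ) (R := ℝ) (X 3 : MvPolynomial (Fin 4) ℚ) 1
  convert ((((((((h0.inter h1).inter h2).inter h3).inter h4).inter h5).inter h6).inter h7).inter h8)
    using 1
  ext w
  simp only [map_add, map_sub, map_mul, map_one, MvPolynomial.aeval_X, mem_setOf_eq, mem_inter_iff]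
  tauto

/-- `W` is open. [folklore] -/
theorem isOpen_W :
    IsOpen {w : Fin 4 → ℝ | 0 < w 0 ∧ 0 < w 1 ∧ w 0 + w 1 < 1 ∧ 0 < w 2 ∧
      w 2 * (1 - w 0 - w 1) < 1 ∧ w 2 * w 0 < 1 ∧ w 2 * w 1 < 1 ∧ 0 < w 3 ∧ w 3 < 1} := by
  simp only [Set.setOf_and]
  refine IsOpen.inter ?_ (IsOpen.inter ?_ (IsOpen.inter ?_ (IsOpen.inter ?_ (IsOpen.inter ?_
    (IsOpen.inter ?_ (IsOpen.inter ?_ (IsOpen.inter ?_ ?_))))))) <;>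
    exact isOpen_lt (by fun_prop) (by fun_prop)

/-- **`c₀` is `ℚ`-semialgebraic** on every `ℚ`-semialgebraic set on which the bases of its real
powers are non-negative, `S > 0` and `y ≠ 0` (explicit composition of semialgebraic operations;
rational powers by `IsSemialgebraicFunOn.rpow_ratCast_of_nonneg`). [cite: BochnakCosteRoy1998, Prop. 2.2.6] -/
theorem isSemialgebraicFunOn_c0 {x s : ℚ} (hx : 2 ≤ x) (hs : 3 ≤ s)
    {Z S H K M0 M1 M2 P c0 : (Fin 4 → ℝ) → ℝ}
    (hZ : ∀ w, Z w = ((1 - w 2 * (1 - w 0 - w 1)) * (1 - w 2 * w 0) * (1 - w 2 * w 1)) ^ ((1:ℝ)/3))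
    (hS : ∀ w, S w = 1 - w 2 * ((1 - w 0 - w 1) * w 0 + (1 - w 0 - w 1) * w 1 + w 0 * w 1) +
      (w 2) ^ 2 * ((1 - w 0 - w 1) * w 0 * w 1))
    (hH : ∀ w, H w = (1 + Z w + Z w ^ 2) / S w)
    (hK : ∀ w, K w = ((1 - w 0 - w 1) * w 0 * w 1) ^ ((s:ℝ) - 1))
    (hM0 : ∀ w, M0 w = (1 - w 2 * (1 - w 0 - w 1)) ^ (x:ℝ) * (1 - w 2 * w 0) ^ ((x:ℝ) - 2/3) *
      (1 - w 2 * w 1) ^ ((x:ℝ) - 1/3))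
    (hM1 : ∀ w, M1 w = (1 - w 2 * (1 - w 0 - w 1)) ^ ((x:ℝ) - 1/3) * (1 - w 2 * w 0) ^ (x:ℝ) *
      (1 - w 2 * w 1) ^ ((x:ℝ) - 2/3))
    (hM2 : ∀ w, M2 w = (1 - w 2 * (1 - w 0 - w 1)) ^ ((x:ℝ) - 2/3) * (1 - w 2 * w 0) ^ ((x:ℝ) - 1/3) *
      (1 - w 2 * w 1) ^ (x:ℝ))
    (hP : ∀ w, P w = (w 3) ^ (3 * (x:ℝ) - 1) * (1 - w 3 * Z w) ^ (3 * (s:ℝ) - 1) * H w ^ (3 * (s:ℝ)) *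
      K w)
    (hc0 : ∀ w, c0 w = -(P w * w 0 * ((1 - w 0 - w 1) * M0 w - (1 - w 0) * M1 w + w 1 * M2 w) / w 2))
    {σ : Set (Fin 4 → ℝ)} (hσ : IsSemialgebraic ℚ σ)
    (hsgn : ∀ w ∈ σ, 0 ≤ 1 - w 2 * (1 - w 0 - w 1) ∧ 0 ≤ 1 - w 2 * w 0 ∧ 0 ≤ 1 - w 2 * w 1 ∧
      0 ≤ (1 - w 0 - w 1) * w 0 * w 1 ∧ 0 < S w ∧ 0 ≤ w 3 ∧ w 3 * Z w ≤ 1 ∧ w 2 ≠ 0) :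
    IsSemialgebraicFunOn ℚ σ c0 := by
  have hw : ∀ i, IsSemialgebraicFunOn ℚ σ (fun w : Fin 4 → ℝ => w i) := isSemialgebraicFunOn_apply hσ
  have h1 : IsSemialgebraicFunOn ℚ σ (fun _ : Fin 4 → ℝ => (1:ℝ)) :=
    isSemialgebraicFunOn_const_of_isAlgebraic hσ isAlgebraic_one
  have hθ0 : IsSemialgebraicFunOn ℚ σ (fun w : Fin 4 → ℝ => 1 - w 0 - w 1) := (h1.fun_sub (hw 0)).fun_sub (hw 1)
  have ht0 : IsSemialgebraicFunOn ℚ σ (fun w : Fin 4 → ℝ => 1 - w 2 * (1 - w 0 - w 1)) :=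
    h1.fun_sub ((hw 2).fun_mul hθ0)
  have ht1 : IsSemialgebraicFunOn ℚ σ (fun w : Fin 4 → ℝ => 1 - w 2 * w 0) := h1.fun_sub ((hw 2).fun_mul (hw 0))
  have ht2 : IsSemialgebraicFunOn ℚ σ (fun w : Fin 4 → ℝ => 1 - w 2 * w 1) := h1.fun_sub ((hw 2).fun_mul (hw 1))
  -- rational powers of the non-negative bases
  have hx0 : (x : ℚ) ≠ 0 := by intro h; rw [h] at hx; norm_num at hx
  have hx1 : (x - 1/3 : ℚ) ≠ 0 := by intro h; linarith
  have hx2 : (x - 2/3 : ℚ) ≠ 0 := by intro h; linarith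
  have rp : ∀ {f : (Fin 4 → ℝ) → ℝ} (_ : IsSemialgebraicFunOn ℚ σ f) (_ : ∀ w ∈ σ, 0 ≤ f w) (e : ℚ)
      (_ : e ≠ 0), IsSemialgebraicFunOn ℚ σ (fun w => f w ^ (e : ℝ)) :=
    fun hf hnn e he => hf.rpow_ratCast_of_nonneg hnn he
  have hZ' : IsSemialgebraicFunOn ℚ σ Z := by
    refine (rp ((ht0.fun_mul ht1).fun_mul ht2) (fun w hw => ?_) (1/3) (by norm_num)).congr
      fun w _ => ?_
    · obtain ⟨a, b, c, -⟩ := hsgn w hw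
      exact mul_nonneg (mul_nonneg a b) c
    · rw [hZ]; push_cast; ring_nf
  have hS' : IsSemialgebraicFunOn ℚ σ S :=
    ((h1.fun_sub ((hw 2).fun_mul (((hθ0.fun_mul (hw 0)).fun_add (hθ0.fun_mul (hw 1))).fun_add
      ((hw 0).fun_mul (hw 1))))).fun_add (((hw 2).fun_pow 2).fun_mul ((hθ0.fun_mul (hw 0)).fun_mul
      (hw 1)))).congr fun w _ => by rw [hS]
  have hH' : IsSemialgebraicFunOn ℚ σ H :=
    (((h1.fun_add hZ').fun_add (hZ'.fun_pow 2)).div hS' fun w hw => (hsgn w hw).2.2.2.2.1.ne').congr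
      fun w _ => by rw [hH]
  have hK' : IsSemialgebraicFunOn ℚ σ K := by
    have hs1 : (s - 1 : ℚ) ≠ 0 := by intro h; linarith
    refine (rp ((hθ0.fun_mul (hw 0)).fun_mul (hw 1)) (fun w hw => (hsgn w hw).2.2.2.1) (s - 1)
      hs1).congr fun w _ => ?_
    rw [hK]; push_cast; ring_nf
  have hM : ∀ {M : (Fin 4 → ℝ) → ℝ} {a b c : ℚ}, a ≠ 0 → b ≠ 0 → c ≠ 0 →
      (∀ w, M w = (1 - w 2 * (1 - w 0 - w 1)) ^ (a:ℝ) * (1 - w 2 * w 0) ^ (b:ℝ) *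
        (1 - w 2 * w 1) ^ (c:ℝ)) → IsSemialgebraicFunOn ℚ σ M := by
    intro M a b c ha hb hc hMe
    exact (((rp ht0 (fun w hw => (hsgn w hw).1) a ha).fun_mul
      (rp ht1 (fun w hw => (hsgn w hw).2.1) b hb)).fun_mul
      (rp ht2 (fun w hw => (hsgn w hw).2.2.1) c hc)).congr fun w _ => by rw [hMe]
  have hM0' : IsSemialgebraicFunOn ℚ σ M0 :=
    hM hx0 hx2 hx1 fun w => by rw [hM0]; push_cast; ring_nf
  have hM1' : IsSemialgebraicFunOn ℚ σ M1 :=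
    hM hx1 hx0 hx2 fun w => by rw [hM1]; push_cast; ring_nf
  have hM2' : IsSemialgebraicFunOn ℚ σ M2 :=
    hM hx2 hx1 hx0 fun w => by rw [hM2]; push_cast; ring_nf
  have hP' : IsSemialgebraicFunOn ℚ σ P := by
    have e1 : (3 * x - 1 : ℚ) ≠ 0 := by intro h; linarith
    have e2 : (3 * s - 1 : ℚ) ≠ 0 := by intro h; linarith
    have e3 : (3 * s : ℚ) ≠ 0 := by intro h; linarith
    have hv := rp (hw 3) (fun w hw => (hsgn w hw).2.2.2.2.2.1) _ e1
    have hq := rp (h1.fun_sub ((hw 3).fun_mul hZ')) (fun w hw => by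
      have := (hsgn w hw).2.2.2.2.2.2.1; linarith) _ e2
    have hr := rp hH' (fun w hw => by
      obtain ⟨a, b, c, -, hS0, -⟩ := hsgn w hw
      rw [hH]
      have hz : 0 ≤ Z w := by rw [hZ]; exact rpow_nonneg (mul_nonneg (mul_nonneg a b) c) _
      positivity) _ e3
    refine (((hv.fun_mul hq).fun_mul hr).fun_mul hK').congr fun w _ => ?_
    rw [hP]; push_cast; ring_nf
  refine ((((hP'.fun_mul (hw 0)).fun_mul (((hθ0.fun_mul hM0').fun_sub ((h1.fun_sub (hw 0)).fun_mul
    hM1')).fun_add ((hw 1).fun_mul hM2'))).div (hw 2) fun w hw => (hsgn w hw).2.2.2.2.2.2.2).fun_neg).congr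
    fun w _ => ?_
  rw [hc0]

/-- **`∂θ₁ c₀` exists and is bounded on `W`** (`x ≥ 2`, `s ≥ 3`): product rule for
`c₀ = −P θ₁ B / y`; the factor `1/y` is absorbed by `|B| ≤ 2xy`, `|∂θ₁B| ≤ 6xy`, and the
compensated bounds on `∂θ₁P`. [folklore] -/
theorem hasDerivAt_c0 {x s : ℚ} (hx : 2 ≤ x) (hs : 3 ≤ s)
    {Z S H K M0 M1 M2 P c0 : (Fin 4 → ℝ) → ℝ}
    (hZ : ∀ w, Z w = ((1 - w 2 * (1 - w 0 - w 1)) * (1 - w 2 * w 0) * (1 - w 2 * w 1)) ^ ((1:ℝ)/3))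
    (hS : ∀ w, S w = 1 - w 2 * ((1 - w 0 - w 1) * w 0 + (1 - w 0 - w 1) * w 1 + w 0 * w 1) +
      (w 2) ^ 2 * ((1 - w 0 - w 1) * w 0 * w 1))
    (hH : ∀ w, H w = (1 + Z w + Z w ^ 2) / S w)
    (hK : ∀ w, K w = ((1 - w 0 - w 1) * w 0 * w 1) ^ ((s:ℝ) - 1))
    (hM0 : ∀ w, M0 w = (1 - w 2 * (1 - w 0 - w 1)) ^ (x:ℝ) * (1 - w 2 * w 0) ^ ((x:ℝ) - 2/3) *
      (1 - w 2 * w 1) ^ ((x:ℝ) - 1/3))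
    (hM1 : ∀ w, M1 w = (1 - w 2 * (1 - w 0 - w 1)) ^ ((x:ℝ) - 1/3) * (1 - w 2 * w 0) ^ (x:ℝ) *
      (1 - w 2 * w 1) ^ ((x:ℝ) - 2/3))
    (hM2 : ∀ w, M2 w = (1 - w 2 * (1 - w 0 - w 1)) ^ ((x:ℝ) - 2/3) * (1 - w 2 * w 0) ^ ((x:ℝ) - 1/3) *
      (1 - w 2 * w 1) ^ (x:ℝ))
    (hP : ∀ w, P w = (w 3) ^ (3 * (x:ℝ) - 1) * (1 - w 3 * Z w) ^ (3 * (s:ℝ) - 1) * H w ^ (3 * (s:ℝ)) *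
      K w)
    (hc0 : ∀ w, c0 w = -(P w * w 0 * ((1 - w 0 - w 1) * M0 w - (1 - w 0) * M1 w + w 1 * M2 w) / w 2))
    {w : Fin 4 → ℝ}
    (hw : 0 < w 0 ∧ 0 < w 1 ∧ w 0 + w 1 < 1 ∧ 0 < w 2 ∧ w 2 * (1 - w 0 - w 1) < 1 ∧ w 2 * w 0 < 1 ∧
      w 2 * w 1 < 1 ∧ 0 < w 3 ∧ w 3 < 1) :
    ∃ e : ℝ, HasDerivAt (fun a => c0 (Function.update w 0 a)) e (w 0) ∧
      |e| ≤ (704 * s + 2 * x * s + 8 * x) * 9 ^ (3 * (s:ℝ)) := by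
  obtain ⟨P₁, P₂, hPd, hP₁, hP₂⟩ := hasDerivAt_P hx hs hZ hS hH hK hP hw
  obtain ⟨B', hBd, hB'⟩ := hasDerivAt_B hx hZ hM0 hM1 hM2 hw
  obtain ⟨hB1, hB2⟩ := B_bounds hx hZ hM0 hM1 hM2 hw
  obtain ⟨hP0, hPG⟩ := P_mem hx hs hZ hS hH hK hP hw
  have hy : 0 < w 2 := hw.2.2.2.1
  have ha0 : 0 < w 0 := hw.1
  have ha1 : w 0 ≤ 1 := by linarith [hw.2.1, hw.2.2.1]
  have hx' : (2:ℝ) ≤ x := by exact_mod_cast hx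
  have hs' : (3:ℝ) ≤ s := by exact_mod_cast hs
  have hd := (((hPd.fun_mul (hasDerivAt_id' (w 0))).fun_mul hBd).div_const (w 2)).fun_neg
  simp only [Function.update_eq_self] at hd
  have hd' : HasDerivAt (fun a => c0 (Function.update w 0 a)) _ (w 0) :=
    hd.congr_of_eventuallyEq (Filter.Eventually.of_forall fun a => by simp only [hc0, update_apply])
  refine ⟨_, hd', ?_⟩
  set G := (9:ℝ) ^ (3 * (s:ℝ)) with hG
  set B := (1 - w 0 - w 1) * M0 w - (1 - w 0) * M1 w + w 1 * M2 w with hB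
  have hG0 : 0 ≤ G := by positivity
  have hz2 : 0 ≤ Z w ^ 2 := sq_nonneg _
  -- the four terms of the numerator
  have t1 : |P₁ * w 0 * B| ≤ 704 * s * G * w 2 := by
    rw [abs_mul, abs_mul, abs_of_pos ha0]
    calc |P₁| * w 0 * |B| ≤ |P₁| * 1 * (2 * Z w ^ 2) := by gcongr
      _ = 2 * (|P₁| * Z w ^ 2) := by ring
      _ ≤ 2 * (352 * s * G * w 2) := by gcongr
      _ = 704 * s * G * w 2 := by ring
  have t2 : |P₂ * w 0 * B| ≤ s * G * (2 * x * w 2) := by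
    rw [abs_mul, abs_mul, abs_of_pos ha0]
    calc |P₂| * w 0 * |B| ≤ (s * G) * 1 * (2 * x * w 2) := by gcongr
      _ = s * G * (2 * x * w 2) := by ring
  have t3 : |P w * B| ≤ G * (2 * x * w 2) := by
    rw [abs_mul, abs_of_nonneg hP0]; gcongr
  have t4 : |P w * w 0 * B'| ≤ G * (6 * x * w 2) := by
    rw [abs_mul, abs_mul, abs_of_nonneg hP0, abs_of_pos ha0]
    calc P w * w 0 * |B'| ≤ G * 1 * (6 * x * w 2) := by gcongr
      _ = G * (6 * x * w 2) := by ring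
  rw [abs_neg, abs_div, abs_of_pos hy, div_le_iff₀ hy]
  calc |((P₁ + P₂) * w 0 + P w * 1) * B + P w * w 0 * B'|
      = |P₁ * w 0 * B + P₂ * w 0 * B + P w * B + P w * w 0 * B'| := by ring_nf
    _ ≤ |P₁ * w 0 * B| + |P₂ * w 0 * B| + |P w * B| + |P w * w 0 * B'| := by
        refine (abs_add_le _ _).trans (add_le_add ((abs_add_le _ _).trans (add_le_add (abs_add_le _ _)
          le_rfl)) le_rfl)
    _ ≤ 704 * s * G * w 2 + s * G * (2 * x * w 2) + G * (2 * x * w 2) + G * (6 * x * w 2) :=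
        add_le_add (add_le_add (add_le_add t1 t2) t3) t4
    _ = (704 * s + 2 * x * s + 8 * x) * G * w 2 := by ring

/-- The base `B₁ = {(θ₂, y, v)}` of the `θ₁`-band is `ℚ`-semialgebraic. [folklore] -/
theorem isSemialgebraic_base :
    IsSemialgebraic ℚ {q : Fin 3 → ℝ | 0 < q 0 ∧ q 0 < 1 ∧ 0 < q 1 ∧ q 1 * q 0 < 1 ∧ q 1 * (1 - q 0) < 2 ∧
      0 < q 2 ∧ q 2 < 1} := by
  have h0 := isSemialgebraic_setOf_eval_pos (k := ℚ) (R := ℝ) (X 0 : MvPolynomial (Fin 3) ℚ)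
  have h1 := isSemialgebraic_setOf_eval_lt (k := ℚ) (R := ℝ) (X 0 : MvPolynomial (Fin 3) ℚ) 1
  have h2 := isSemialgebraic_setOf_eval_pos (k := ℚ) (R := ℝ) (X 1 : MvPolynomial (Fin 3) ℚ)
  have h3 := isSemialgebraic_setOf_eval_lt (k := ℚ) (R := ℝ) (X 1 * X 0 : MvPolynomial (Fin 3) ℚ) 1
  have h4 := isSemialgebraic_setOf_eval_lt (k := ℚ) (R := ℝ) (X 1 * (1 - X 0) : MvPolynomial (Fin 3) ℚ) 2
  have h5 := isSemialgebraic_setOf_eval_pos (k := ℚ) (R := ℝ) (X 2 : MvPolynomial (Fin 3) ℚ)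
  have h6 := isSemialgebraic_setOf_eval_lt (k := ℚ) (R := ℝ) (X 2 : MvPolynomial (Fin 3) ℚ) 1
  convert ((((((h0.inter h1).inter h2).inter h3).inter h4).inter h5).inter h6) using 1
  ext q
  simp only [map_sub, map_mul, map_one, map_ofNat, MvPolynomial.aeval_X, mem_setOf_eq, mem_inter_iff]
  tauto

/-- The ends `a = max 0 (1 − θ₂ − 1/y)`, `b = min (1 − θ₂) (1/y)` of the `θ₁`-fibres are
`ℚ`-semialgebraic on the base (`max`/`min` through `|·|`). [folklore] -/
theorem isSemialgebraicFunOn_ends {B : Set (Fin 3 → ℝ)} (hB : IsSemialgebraic ℚ B) :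
    IsSemialgebraicFunOn ℚ B (fun q => max 0 (1 - q 0 - (q 1)⁻¹)) ∧
      IsSemialgebraicFunOn ℚ B (fun q => min (1 - q 0) (q 1)⁻¹) := by
  have h1 : IsSemialgebraicFunOn ℚ B (fun _ : Fin 3 → ℝ => (1:ℝ)) :=
    isSemialgebraicFunOn_const_of_isAlgebraic hB isAlgebraic_one
  have hh : IsSemialgebraicFunOn ℚ B (fun _ : Fin 3 → ℝ => ((1/2 : ℚ) : ℝ)) := isSemialgebraicFunOn_ratCast hB _
  have hg : IsSemialgebraicFunOn ℚ B (fun q : Fin 3 → ℝ => 1 - q 0 - (q 1)⁻¹) :=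
    (h1.fun_sub (isSemialgebraicFunOn_apply hB 0)).fun_sub (isSemialgebraicFunOn_apply hB 1).fun_inv
  have hp : IsSemialgebraicFunOn ℚ B (fun q : Fin 3 → ℝ => 1 - q 0) := h1.fun_sub (isSemialgebraicFunOn_apply hB 0)
  have hr : IsSemialgebraicFunOn ℚ B (fun q : Fin 3 → ℝ => (q 1)⁻¹) := (isSemialgebraicFunOn_apply hB 1).fun_inv
  constructor
  · refine (hh.fun_mul (hg.fun_add hg.abs)).congr fun q _ => ?_
    beta_reduce
    rcases le_total 0 (1 - q 0 - (q 1)⁻¹) with h | h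
    · rw [max_eq_right h, abs_of_nonneg h]; push_cast; ring
    · rw [max_eq_left h, abs_of_nonpos h]; push_cast; ring
  · refine (hh.fun_mul ((hp.fun_add hr).fun_sub (hp.fun_sub hr).abs)).congr fun q _ => ?_
    beta_reduce
    rcases le_total (1 - q 0) (q 1)⁻¹ with h | h
    · rw [min_eq_left h, abs_of_nonpos (by linarith : 1 - q 0 - (q 1)⁻¹ ≤ 0)]; push_cast; ring
    · rw [min_eq_right h, abs_of_nonneg (by linarith : (0:ℝ) ≤ 1 - q 0 - (q 1)⁻¹)]; push_cast; ring

/-- `W` fibred over `(θ₂, y, v)`: `w ∈ W` iff `(θ₂, y, v) ∈ B₁` and `a < θ₁ < b`. [folklore] -/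
theorem mem_W_iff (w : Fin 4 → ℝ) :
    (0 < w 0 ∧ 0 < w 1 ∧ w 0 + w 1 < 1 ∧ 0 < w 2 ∧ w 2 * (1 - w 0 - w 1) < 1 ∧ w 2 * w 0 < 1 ∧
      w 2 * w 1 < 1 ∧ 0 < w 3 ∧ w 3 < 1) ↔
    (0 < w 1 ∧ w 1 < 1 ∧ 0 < w 2 ∧ w 2 * w 1 < 1 ∧ w 2 * (1 - w 1) < 2 ∧ 0 < w 3 ∧ w 3 < 1) ∧
      max 0 (1 - w 1 - (w 2)⁻¹) < w 0 ∧ w 0 < min (1 - w 1) (w 2)⁻¹ := by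
  rw [max_lt_iff, lt_min_iff]
  constructor
  · rintro ⟨h0, h1, h01, hy, ha, hb, hc, hv, hv'⟩
    have hr : w 2 * (w 2)⁻¹ = 1 := mul_inv_cancel₀ hy.ne'
    have hr0 : 0 < (w 2)⁻¹ := inv_pos.mpr hy
    refine ⟨⟨h1, by linarith, hy, hc, by nlinarith, hv, hv'⟩, ⟨h0, ?_⟩, by linarith, ?_⟩
    · by_contra h; push Not at h
      nlinarith [mul_le_mul_of_nonneg_left h hy.le]
    · by_contra h; push Not at h
      nlinarith [mul_le_mul_of_nonneg_left h hy.le]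
  · rintro ⟨⟨h1, h1', hy, hc, h2, hv, hv'⟩, ⟨h0, ha⟩, hb, hb'⟩
    have hr : w 2 * (w 2)⁻¹ = 1 := mul_inv_cancel₀ hy.ne'
    refine ⟨h0, h1, by linarith, hy, ?_, ?_, hc, hv, hv'⟩
    · nlinarith [mul_lt_mul_of_pos_left ha hy]
    · nlinarith [mul_lt_mul_of_pos_left hb' hy]

/-- Sign conditions on the CLOSED `θ₁`-fibres: for `(θ₂, y, v) ∈ B₁` and `a ≤ θ₁ ≤ b` the box
coordinates `t₀, t₁` lie in `[0,1]`, `t₂ ∈ (0,1)`, `θ₀, θ₁ ≥ 0`, `y < 3` and `t₀t₁t₂ < 1`. [folklore] -/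
theorem band_sign {w : Fin 4 → ℝ}
    (hq : 0 < w 1 ∧ w 1 < 1 ∧ 0 < w 2 ∧ w 2 * w 1 < 1 ∧ w 2 * (1 - w 1) < 2 ∧ 0 < w 3 ∧ w 3 < 1)
    (ha : max 0 (1 - w 1 - (w 2)⁻¹) ≤ w 0) (hb : w 0 ≤ min (1 - w 1) (w 2)⁻¹) :
    (0 ≤ 1 - w 2 * (1 - w 0 - w 1) ∧ 1 - w 2 * (1 - w 0 - w 1) ≤ 1) ∧
      (0 ≤ 1 - w 2 * w 0 ∧ 1 - w 2 * w 0 ≤ 1) ∧ (0 < 1 - w 2 * w 1 ∧ 1 - w 2 * w 1 < 1) ∧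
      0 ≤ 1 - w 0 - w 1 ∧ 0 ≤ w 0 ∧ w 2 < 3 ∧
      (1 - w 2 * (1 - w 0 - w 1)) * (1 - w 2 * w 0) * (1 - w 2 * w 1) < 1 := by
  rw [max_le_iff] at ha
  rw [le_min_iff] at hb
  obtain ⟨h1, h1', hy, hc, h2, -, -⟩ := hq
  obtain ⟨h0, ha⟩ := ha
  obtain ⟨hb, hb'⟩ := hb
  have hr : w 2 * (w 2)⁻¹ = 1 := mul_inv_cancel₀ hy.ne'
  have e1 : w 2 * (1 - w 0 - w 1) ≤ 1 := by nlinarith [mul_le_mul_of_nonneg_left ha hy.le]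
  have e2 : w 2 * w 0 ≤ 1 := by nlinarith [mul_le_mul_of_nonneg_left hb' hy.le]
  have t00 : 0 ≤ 1 - w 2 * (1 - w 0 - w 1) := by linarith
  have t01 : 1 - w 2 * (1 - w 0 - w 1) ≤ 1 := by nlinarith
  have t10 : 0 ≤ 1 - w 2 * w 0 := by linarith
  have t11 : 1 - w 2 * w 0 ≤ 1 := by nlinarith
  have t20 : 0 < 1 - w 2 * w 1 := by linarith
  have t21 : 1 - w 2 * w 1 < 1 := by nlinarith
  refine ⟨⟨t00, t01⟩, ⟨t10, t11⟩, ⟨t20, t21⟩, by linarith, h0, by nlinarith, ?_⟩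
  calc (1 - w 2 * (1 - w 0 - w 1)) * (1 - w 2 * w 0) * (1 - w 2 * w 1) ≤ 1 * 1 * (1 - w 2 * w 1) := by
        gcongr
    _ < 1 := by linarith

end CornerTheta1

/-- **The `θ₁`-derivative of `c₀` on `W`** (registered sub-goal `cornerStokesTheta1Aux` of
`stub_gmThreeShifted`): for `x ≥ 2`, `s ≥ 3` there is a function `d`, `ℚ`-semialgebraic and bounded
on `W`, with `∂θ₁ c₀(w) = d w` at every `w ∈ W`. The derivative exists by the product/chain rule
(all bases of the real powers are positive on the open set `W`); it is bounded because the bracket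
`θ₀M0 − (1−θ₁)M1 + θ₂M2 = O(y)` absorbs the `1/y` and the singular `∂θ₁Z ∼ (t₀t₁t₂)^{−2/3}` is
compensated by `M_k ≤ Z²`; it is semialgebraic as the line derivative of a semialgebraic function
(Basu–Pollack–Roy, Prop. 3.22). [cite: KontsevichZagier2001, §1.2 rule (3)] -/
theorem cornerStokesTheta1Aux : ∀ (x s : ℚ), 2 ≤ x → 3 ≤ s → ∀ (Z S H K M0 M1 M2 P : (Fin 4 → ℝ) → ℝ),
    (∀ w, Z w = ((1 - w 2 * (1 - w 0 - w 1)) * (1 - w 2 * w 0) * (1 - w 2 * w 1)) ^ ((1:ℝ)/3)) →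
    (∀ w, S w = 1 - w 2 * ((1 - w 0 - w 1) * w 0 + (1 - w 0 - w 1) * w 1 + w 0 * w 1) +
      (w 2) ^ 2 * ((1 - w 0 - w 1) * w 0 * w 1)) →
    (∀ w, H w = (1 + Z w + Z w ^ 2) / S w) →
    (∀ w, K w = ((1 - w 0 - w 1) * w 0 * w 1) ^ ((s:ℝ) - 1)) →
    (∀ w, M0 w = (1 - w 2 * (1 - w 0 - w 1)) ^ (x:ℝ) * (1 - w 2 * w 0) ^ ((x:ℝ) - 2/3) * (1 - w 2 * w 1) ^ ((x:ℝ) - 1/3)) →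
    (∀ w, M1 w = (1 - w 2 * (1 - w 0 - w 1)) ^ ((x:ℝ) - 1/3) * (1 - w 2 * w 0) ^ (x:ℝ) * (1 - w 2 * w 1) ^ ((x:ℝ) - 2/3)) →
    (∀ w, M2 w = (1 - w 2 * (1 - w 0 - w 1)) ^ ((x:ℝ) - 2/3) * (1 - w 2 * w 0) ^ ((x:ℝ) - 1/3) * (1 - w 2 * w 1) ^ (x:ℝ)) →
    (∀ w, P w = (w 3) ^ (3 * (x:ℝ) - 1) * (1 - w 3 * Z w) ^ (3 * (s:ℝ) - 1) * H w ^ (3 * (s:ℝ)) * K w) →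
    ∀ (c0 : (Fin 4 → ℝ) → ℝ), (∀ w, c0 w = -(P w * w 0 * ((1 - w 0 - w 1) * M0 w - (1 - w 0) * M1 w + w 1 * M2 w) / w 2)) →
    ∃ d : (Fin 4 → ℝ) → ℝ, IsSemialgebraicFunOn ℚ {w : Fin 4 → ℝ | 0 < w 0 ∧ 0 < w 1 ∧ w 0 + w 1 < 1 ∧ 0 < w 2 ∧ w 2 * (1 - w 0 - w 1) < 1 ∧ w 2 * w 0 < 1 ∧ w 2 * w 1 < 1 ∧ 0 < w 3 ∧ w 3 < 1} d ∧
      (∃ C : ℝ, ∀ w ∈ {w : Fin 4 → ℝ | 0 < w 0 ∧ 0 < w 1 ∧ w 0 + w 1 < 1 ∧ 0 < w 2 ∧ w 2 * (1 - w 0 - w 1) < 1 ∧ w 2 * w 0 < 1 ∧ w 2 * w 1 < 1 ∧ 0 < w 3 ∧ w 3 < 1}, |d w| ≤ C) ∧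
      ∀ w ∈ {w : Fin 4 → ℝ | 0 < w 0 ∧ 0 < w 1 ∧ w 0 + w 1 < 1 ∧ 0 < w 2 ∧ w 2 * (1 - w 0 - w 1) < 1 ∧ w 2 * w 0 < 1 ∧ w 2 * w 1 < 1 ∧ 0 < w 3 ∧ w 3 < 1},
        HasDerivAt (fun a => c0 (Function.update w 0 a)) (d w) (w 0) := by
  intro x s hx hs Z S H K M0 M1 M2 P hZ hS hH hK hM0 hM1 hM2 hP c0 hc0
  set W : Set (Fin 4 → ℝ) := {w : Fin 4 → ℝ | 0 < w 0 ∧ 0 < w 1 ∧ w 0 + w 1 < 1 ∧ 0 < w 2 ∧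
    w 2 * (1 - w 0 - w 1) < 1 ∧ w 2 * w 0 < 1 ∧ w 2 * w 1 < 1 ∧ 0 < w 3 ∧ w 3 < 1} with hW
  have hWsa : IsSemialgebraic ℚ W := CornerTheta1.isSemialgebraic_W
  have hWo : IsOpen W := CornerTheta1.isOpen_W
  have hder : ∀ w ∈ W, ∃ e : ℝ, HasDerivAt (fun a => c0 (Function.update w 0 a)) e (w 0) ∧
      |e| ≤ (704 * s + 2 * x * s + 8 * x) * 9 ^ (3 * (s:ℝ)) :=
    fun w hw => CornerTheta1.hasDerivAt_c0 hx hs hZ hS hH hK hM0 hM1 hM2 hP hc0 hw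
  refine ⟨fun w => deriv (fun a => c0 (Function.update w 0 a)) (w 0), ?_,
    ⟨(704 * s + 2 * x * s + 8 * x) * 9 ^ (3 * (s:ℝ)), fun w hw => ?_⟩, fun w hw => ?_⟩
  · -- semialgebraicity: the line derivative of a semialgebraic function
    have hc0sa : IsSemialgebraicFunOn ℚ W c0 := by
      refine CornerTheta1.isSemialgebraicFunOn_c0 hx hs hZ hS hH hK hM0 hM1 hM2 hP hc0 hWsa
        fun w hw => ?_
      obtain ⟨-, ⟨h0, -⟩, ⟨h1, -⟩, ⟨h2, -⟩, hb, -⟩ := CornerTheta1.basic hw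
      obtain ⟨hs0, -⟩ := CornerTheta1.S_mem hS hw
      obtain ⟨-, hz1⟩ := CornerTheta1.Z_mem hZ hw
      have hv0 : 0 < w 3 := hw.2.2.2.2.2.2.2.1
      have hv1 : w 3 < 1 := hw.2.2.2.2.2.2.2.2
      exact ⟨h0.le, h1.le, h2.le, hb.le, by linarith, hv0.le, by nlinarith, hw.2.2.2.1.ne'⟩
    refine IsSemialgebraicFunOn.of_hasLineDerivAt 0 hc0sa hWsa Subset.rfl (fun p hp => ?_)
      fun p hp => ?_
    · have hc : Continuous fun t : ℝ => p + t • (Pi.single 0 1 : Fin 4 → ℝ) :=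
        continuous_const.add (continuous_id.smul continuous_const)
      have h0 : p + (0:ℝ) • (Pi.single 0 1 : Fin 4 → ℝ) = p := by simp
      exact hc.continuousAt.preimage_mem_nhds (by rw [h0]; exact hWo.mem_nhds hp)
    · obtain ⟨e, he, -⟩ := hder p hp
      have hd := he.differentiableAt.hasDerivAt
      have key : ∀ t : ℝ, p + t • (Pi.single 0 1 : Fin 4 → ℝ) = Function.update p 0 (p 0 + t) := by
        intro t; ext j
        by_cases hj : j = 0
        · subst hj; simp
        · simp [hj]
      show HasDerivAt (fun t => c0 (p + t • Pi.single 0 1)) _ 0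
      simp only [key]
      exact HasDerivAt.comp_const_add (p 0) 0 (by rw [add_zero]; exact hd)
  · obtain ⟨e, he, hb⟩ := hder w hw
    beta_reduce; rw [he.deriv]; exact hb
  · obtain ⟨e, he, -⟩ := hder w hw
    exact he.differentiableAt.hasDerivAt

end Summit.KontsevichZagierPeriods.TerasomaMultiplication.MultiplicationAccessible

end
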